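import Literature.AlgebraicGeometry.Motives.HodgeStructureIsotypicComponents
import Literature.AlgebraicGeometry.Motives.MumfordTateGroupDirectSum
import HarnessLib

/-!
# Morphisms between finite direct sums of Hodge structures are determined by their blocks; for pairwise
# non-isomorphic irreducible summands ("representatives for the simple isogeny factors") all morphisms between
# distinct summands — and between their powers — vanish (Milne 1999, hypothesis of Propositions 1.1 / 1.5)

[topic AlgebraicGeometry/Motives]

Layer `Literature/AlgebraicGeometry/Motives`, lane `lit-hodgefound` (Track 2 foundations library; seat `lit-hodgefound-p34`,
generation 21, self-proposed row g21-#4, FILE 1). One small definition WITH BODY (`Hom.piBlock`) and theorems; no named fact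
(net debt `0`). Purpose: turn Milne's hypothesis of Propositions 1.1 / 1.5 — "`A₁, …, A_s` a set of representatives for the
simple isogeny factors of `A`, so that there exists an isogeny `A₁^{r₁} × ⋯ × A_s^{r_s} → A`" — into the `Hom`-orthogonality
hypothesis `h0 : ∀ i j, i ≠ j → ∀ φ : Hom (H j) (H i), φ.toLinearMap = 0` under which the seat's g21-#2 files
`Motives/HodgeStructureLefschetzGroupFiniteDirectSum` (`centralizerPiAlgEquiv`, `Polarization.lefschetzGroupPiMulEquiv`) and
`Motives/HodgeStructureLefschetzGroupFiniteDirectSumPoints` (`Polarization.lefschetzGroupBaseChangePiMulEquiv`) give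
`C(⊕_j H_j) = ∏_j C(H_j)` and `S(⊕_j H_j)(K) = ∏_j S(H_j)(K)`: (a) irreducible ("simple") pairwise non-isomorphic Hodge
structures are pairwise `Hom`-orthogonal (Schur, the tree's `Hom.eq_zero_of_not_exists_hom_bijective` of
`Motives/HodgeStructureIsotypicComponents`), and (b) so are their POWERS `H_j^{⊕κ_j}` (a morphism between finite direct sums
vanishes iff its blocks do). The packaging `S(⊕_j H_j^{⊕κ_j})(K) ≃* ∏_j S(H_j)(K)` is FILE 2 (it imports the g21-#2 files).
CARRIER: the tree's finite direct sum `HodgeStructure.pi H` (`Motives/HodgeStructureDirectSum`) with its coordinate morphisms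
`Hom.piSingle` (`Motives/MumfordTateGroupDirectSum`) and `Hom.piProj` (`Motives/HodgeStructureAbelianTypeDirectSum`);
irreducibility `HodgeStructure.IsIrreducible` (`Motives/HodgeStructureK3Type`) and "isomorphic" as
`∃ g : Hom H₁ H₂, Function.Bijective g.toLinearMap` (`Motives/HodgeStructureIsotypicComponents`).

## The sources, verbatim

* J. S. Milne, *Lefschetz classes on abelian varieties*, Duke Math. J. **96** (1999) 639–675 [Milne1999LefschetzClasses]
  (held `paper:doi-10-1215-s0012-7094-99-09620-5`), §1 p0005 L14–L16 (p. 643): "Let `A = A₁ × ⋯ × A_s`. Then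
  `C(A) ⊂ C(A₁) × ⋯ × C(A_s)`, with equality holding if and only if `Hom(Aᵢ, Aⱼ) = 0` for all `i, j`, `i ≠ j`."; L27–L31:
  "**Proposition 1.1.** Let `A₁, …, A_s` be a set of representatives for the simple isogeny factors of `A`, so that there
  exists an isogeny `A₁^{r₁} × ⋯ × A_s^{r_s} → A` for some `rᵢ > 0`. Any such isogeny induces an isomorphism
  `C(A₁) × ⋯ × C(A_s) → C(A)`"; p0006 L24–L29 (p. 644): "**Proposition 1.5.** […] Any such isogeny induces an isomorphism
  `S(A₁) × ⋯ × S(A_s) → S(A)`".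
* D. Huybrechts, *Lectures on K3 Surfaces* (CUP 2016) [Huybrechts2016K3], Ch. 3 Cor. 3.3.6 (p. 65) (Schur's lemma for
  irreducible Hodge structures: a non-zero morphism between irreducible Hodge structures is an isomorphism) — the tree's
  `Hom.bijective_of_ne_zero` / `Hom.eq_zero_of_not_exists_hom_bijective`.
* P. Deligne, *Théorie de Hodge II* [DeligneHodgeII1971], 2.1 (the abelian category of Hodge structures; direct sums).

## What is PROVED

* §1 DEF `Hom.piBlock Φ a b : Hom (H a) (H' b)` = `pr_b ∘ Φ ∘ in_a` for `Φ : ⊕_a H_a → ⊕_b H'_b`;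
  `Hom.toLinearMap_apply_eq_sum_piBlock` (`(Φ x)_b = Σ_a Φ_{ba}(x_a)`); **`Hom.toLinearMap_eq_zero_iff_piBlock`** (`Φ = 0` iff all
  blocks vanish).
* §2 `Hom.toLinearMap_eq_zero_of_isIrreducible` (Schur, on underlying maps);
  **`forall_hom_toLinearMap_eq_zero_of_isIrreducible`**: irreducible pairwise non-isomorphic `H_j` are pairwise `Hom`-orthogonal
  (exactly the hypothesis `h0` of g21-#2); `forall_hom_toLinearMap_eq_zero_of_isIrreducible_of_finrank_ne` (a checkable
  non-degenerate instance: irreducible summands of pairwise distinct dimensions); **`forall_hom_pi_const_toLinearMap_eq_zero`**: `Hom`-orthogonality passes to the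
  powers `H_j^{⊕κ_j} = HodgeStructure.pi (fun _ : κ_j ↦ H_j)`; `forall_hom_pi_const_toLinearMap_eq_zero_of_isIrreducible` (both
  combined: Milne's "`A₁^{r₁} × ⋯ × A_s^{r_s}`" situation).

NOT here: isogenies / the isogeny category itself (an isogeny of abelian varieties is an isomorphism of rational Hodge
structures `H¹`; here "isomorphic" is a bijective morphism), existence and uniqueness of the decomposition into irreducibles
(`Motives/HodgeStructureIrreducibleDecomposition`, `Motives/HodgeStructureIsotypicComponents` BY NAME), and the group /
algebra packaging (FILE 2).
-/

noncomputable section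

namespace Literature.AlgebraicGeometry.Motives

namespace HodgeStructure

universe u

variable {ι : Type} [Fintype ι] [DecidableEq ι] {W : ι → Type u} [∀ j, AddCommGroup (W j)] [∀ j, Module ℚ (W j)]
  {ι' : Type} [Fintype ι'] [DecidableEq ι'] {W' : ι' → Type u} [∀ b, AddCommGroup (W' b)] [∀ b, Module ℚ (W' b)]
  {n : ℤ} (H : ∀ j, HodgeStructure (W j) n) (H' : ∀ b, HodgeStructure (W' b) n)

/-! ## §1 The blocks `pr_b ∘ Φ ∘ in_a : H_a → H'_b` of a morphism `Φ : ⊕_a H_a → ⊕_b H'_b` -/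

variable {H H'} in
/-- **The `(b, a)`-block `pr_b Φ in_a : H_a → H'_b` of a morphism `Φ : ⊕_a H_a → ⊕_b H'_b`** (a composite of morphisms of
Hodge structures). [cite: DeligneHodgeII1971, 2.1] [cite: Milne1999LefschetzClasses, §1 p. 643 ("C(A) ⊂ C(A₁) × ⋯ × C(A_s)")] -/
def Hom.piBlock (Φ : Hom (pi H) (pi H')) (a : ι) (b : ι') : Hom (H a) (H' b) :=
  (Hom.piProj H' b).comp (Φ.comp (Hom.piSingle H a))

variable {H H'} in
/-- The underlying map of the block is `pr_b ∘ Φ ∘ in_a`. [cite: DeligneHodgeII1971, 2.1] -/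
@[simp] theorem Hom.piBlock_toLinearMap (Φ : Hom (pi H) (pi H')) (a : ι) (b : ι') :
    (Φ.piBlock a b).toLinearMap = LinearMap.proj b ∘ₗ Φ.toLinearMap ∘ₗ LinearMap.single ℚ W a :=
  rfl

omit [DecidableEq ι'] in
variable {H H'} in
/-- **A morphism between finite direct sums is the sum of its blocks**: `Φ = Σ_a Σ_b in_b (pr_b Φ in_a) pr_a`.
[cite: DeligneHodgeII1971, 2.1] [cite: Milne1999LefschetzClasses, §1 p. 643] -/
theorem Hom.toLinearMap_apply_eq_sum_piBlock [DecidableEq ι'] (Φ : Hom (pi H) (pi H')) (x : ∀ j, W j) (b : ι') :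
    Φ.toLinearMap x b = ∑ a, (Φ.piBlock a b).toLinearMap (x a) := by
  conv_lhs => rw [← Finset.univ_sum_single x, map_sum, Finset.sum_apply]
  refine Finset.sum_congr rfl fun a _ ↦ ?_
  rw [Hom.piBlock_toLinearMap]
  rfl

variable {H H'} in
/-- **A morphism between finite direct sums vanishes iff all its blocks vanish.** [cite: DeligneHodgeII1971, 2.1] [cite: Milne1999LefschetzClasses, §1 p. 643 ("with equality holding if and only if Hom(A_i, A_j) = 0")] -/
theorem Hom.toLinearMap_eq_zero_iff_piBlock (Φ : Hom (pi H) (pi H')) :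
    Φ.toLinearMap = 0 ↔ ∀ a b, (Φ.piBlock a b).toLinearMap = 0 := by
  constructor
  · intro h a b
    rw [Hom.piBlock_toLinearMap, h, LinearMap.zero_comp, LinearMap.comp_zero]
  · intro h
    refine LinearMap.ext fun x ↦ funext fun b ↦ ?_
    rw [Hom.toLinearMap_apply_eq_sum_piBlock, LinearMap.zero_apply, Pi.zero_apply]
    exact Finset.sum_eq_zero fun a _ ↦ by rw [h a b, LinearMap.zero_apply]

/-! ## §2 Schur: pairwise non-isomorphic irreducible summands are pairwise `Hom`-orthogonal, and so are their powers -/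

section Schur

variable {V₁ : Type u} [AddCommGroup V₁] [Module ℚ V₁] {V₂ : Type u} [AddCommGroup V₂] [Module ℚ V₂]
  {H₁ : HodgeStructure V₁ n} {H₂ : HodgeStructure V₂ n}

/-- **Schur**: a morphism between non-isomorphic irreducible Hodge structures has underlying map `0` (the tree's
`Hom.eq_zero_of_not_exists_hom_bijective`, restated on `toLinearMap` — the shape of the `Hom`-orthogonality hypothesis
`h0` of `Motives/HodgeStructureLefschetzGroupFiniteDirectSum(Points)`). [cite: Huybrechts2016K3, Ch. 3 Cor. 3.3.6 (p. 65)] [cite: Milne1999LefschetzClasses, §1 Proposition 1.1 ("representatives for the simple isogeny factors")] -/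
theorem Hom.toLinearMap_eq_zero_of_isIrreducible (h₁ : H₁.IsIrreducible) (h₂ : H₂.IsIrreducible)
    (hne : ¬ ∃ g : Hom H₁ H₂, Function.Bijective g.toLinearMap) (φ : Hom H₁ H₂) : φ.toLinearMap = 0 := by
  rw [Hom.eq_zero_of_not_exists_hom_bijective h₁ h₂ hne φ]
  rfl

end Schur

omit [Fintype ι] [DecidableEq ι] in
/-- **Milne's hypothesis "`A₁, …, A_s` a set of representatives for the simple isogeny factors" yields pairwise
`Hom`-orthogonality**: for irreducible, pairwise non-isomorphic `H_j`, every morphism `H_j → H_i` (`i ≠ j`) has underlying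
map `0`. [cite: Milne1999LefschetzClasses, §1 Propositions 1.1 and 1.5] [cite: Huybrechts2016K3, Ch. 3 Cor. 3.3.6] -/
theorem forall_hom_toLinearMap_eq_zero_of_isIrreducible (hirr : ∀ j, (H j).IsIrreducible)
    (hniso : ∀ i j, i ≠ j → ¬ ∃ g : Hom (H j) (H i), Function.Bijective g.toLinearMap) :
    ∀ i j, i ≠ j → ∀ φ : Hom (H j) (H i), φ.toLinearMap = 0 := fun i j hij φ ↦
  Hom.toLinearMap_eq_zero_of_isIrreducible (hirr j) (hirr i) (hniso i j hij) φ

omit [Fintype ι] [DecidableEq ι] in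
/-- **A checkable non-degenerate instance of the hypothesis**: irreducible Hodge structures of pairwise DISTINCT dimensions are
pairwise non-isomorphic (isomorphic Hodge structures have equal dimension), hence pairwise `Hom`-orthogonal.
[cite: Milne1999LefschetzClasses, §1 Propositions 1.1 and 1.5] [cite: Huybrechts2016K3, Ch. 3 Cor. 3.3.6] -/
theorem forall_hom_toLinearMap_eq_zero_of_isIrreducible_of_finrank_ne (hirr : ∀ j, (H j).IsIrreducible)
    (hdim : ∀ i j, i ≠ j → Module.finrank ℚ (W j) ≠ Module.finrank ℚ (W i)) :
    ∀ i j, i ≠ j → ∀ φ : Hom (H j) (H i), φ.toLinearMap = 0 :=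
  forall_hom_toLinearMap_eq_zero_of_isIrreducible H hirr fun i j hij h ↦
    hdim i j hij (finrank_eq_of_exists_hom_bijective h)

omit [Fintype ι] [DecidableEq ι] in
/-- **Powers of pairwise `Hom`-orthogonal Hodge structures are pairwise `Hom`-orthogonal**: if every morphism
`H_j → H_i` (`i ≠ j`) vanishes, so does every morphism `H_j^{⊕κ_j} → H_i^{⊕κ_i}` (its blocks are morphisms `H_j → H_i`) —
the passage from "`A₁, …, A_s`" to "`A₁^{r₁} × ⋯ × A_s^{r_s}`". [cite: Milne1999LefschetzClasses, §1 Propositions 1.1 and 1.5 ("there exists an isogeny A₁^{r₁} × ⋯ × A_s^{r_s} → A")] -/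
theorem forall_hom_pi_const_toLinearMap_eq_zero (κ : ι → Type) [∀ j, Fintype (κ j)] [∀ j, DecidableEq (κ j)]
    (h0 : ∀ i j, i ≠ j → ∀ φ : Hom (H j) (H i), φ.toLinearMap = 0) :
    ∀ i j, i ≠ j → ∀ Φ : Hom (pi fun _ : κ j ↦ H j) (pi fun _ : κ i ↦ H i), Φ.toLinearMap = 0 :=
  fun i j hij Φ ↦ (Hom.toLinearMap_eq_zero_iff_piBlock Φ).2 fun a b ↦ h0 i j hij (Φ.piBlock a b)

omit [Fintype ι] [DecidableEq ι] in
/-- The two previous statements combined: for irreducible pairwise non-isomorphic `H_j`, the powers `H_j^{⊕κ_j}` are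
pairwise `Hom`-orthogonal. [cite: Milne1999LefschetzClasses, §1 Propositions 1.1 and 1.5] [cite: Huybrechts2016K3, Ch. 3 Cor. 3.3.6] -/
theorem forall_hom_pi_const_toLinearMap_eq_zero_of_isIrreducible (κ : ι → Type) [∀ j, Fintype (κ j)]
    [∀ j, DecidableEq (κ j)] (hirr : ∀ j, (H j).IsIrreducible)
    (hniso : ∀ i j, i ≠ j → ¬ ∃ g : Hom (H j) (H i), Function.Bijective g.toLinearMap) :
    ∀ i j, i ≠ j → ∀ Φ : Hom (pi fun _ : κ j ↦ H j) (pi fun _ : κ i ↦ H i), Φ.toLinearMap = 0 :=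
  forall_hom_pi_const_toLinearMap_eq_zero H κ (forall_hom_toLinearMap_eq_zero_of_isIrreducible H hirr hniso)

end HodgeStructure

end Literature.AlgebraicGeometry.Motives
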